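import Summits.BirchSwinnertonDyer.BirchSwinnertonDyer.Theorems.RamifiedSevenEllipticUnitsStrictTorsionOfGZK
import Summits.BirchSwinnertonDyer.BirchSwinnertonDyer.Theorems.RamifiedSevenEllipticUnitsFrameDataSevenOfGZK
import Summits.BirchSwinnertonDyer.BirchSwinnertonDyer.Theorems.RamifiedSevenEllipticUnitsIndexIffLeaf
import Summits.BirchSwinnertonDyer.Rank1Residual.Additive.StrictSelmerDominatesSha
import HarnessLib

set_option linter.dupNamespace false
set_option autoImplicit false

/-!
# Route `RamifiedSevenEllipticUnits` (rung K7r), crux #3 `StrictTorsionSeven`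
# (stmt-BirchSwinnertonDyer-19144): the EXACT CONTENT of the fact-free item —
# `StrictTorsionSeven ⟺ Sel_str(W/ℚ)[7^∞]` finite for every globally minimal `W ∈ 𝒞₇`,
# with the shadow `Ш(W/ℚ)[7^∞]` finite, and the rung leaf from crux #2 plus the published facts

Cell `bsd-cm`, seat `bsd-cm-k7r-c3` (D-0074, gen 2). HONEST FRAMING: BSD is not proved by any of this;
nothing here closes the item's fact-free signature; a closed item closes a rung leaf, never the summit.

State of crux #3 before this file (all kernel theorems of the cell): in analytic rank one (R-tors)@7
needs no Euler system (`strictTorsionSeven_of_finite_base`, seat g0, `…StrictTorsionOfBase`); crux #4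
`StrictControlSeven` is PROVED (`StrictControlSeven_proof`, k7r-c4 g0) and its finiteness-free count
(D♮) `#Sel_𝔭(K, W[7^∞]) = #Sel_str(W/ℚ)[7^∞] · #Sel_str(W'/ℚ)[7^∞]` at every frame
(`natCard_selmerAcBase_frame_eq_mul`, `finite_selmerAcBase_frame_iff`, k7r-c4 g2,
`…StrictTorsionOfGZK`) gives `strictTorsionSeven_of_GZK : GZK → StrictTorsionSeven` and
`strictTorsionSeven_of_publishedFactsSeven` — crux #3 DISCHARGED modulo the one named published fact
`rank_eq_analyticRank_of_analyticRank_le_one` (Gross–Zagier 1986 + Kolyvagin 1990), conjunct 7 of the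
route's own support item `PublishedFactsSeven` (stmt-19147).

THIS FILE answers the remaining question «can the item close AS FILED (fact-free)?» in the kernel:

* §1 `finite_selmerAcBase_of_ramifiedCMStrictTorsionAt`: (R-tors) at a framed `W ∈ 𝒞₇` FORCES
  Castella's `Sel_𝔭(K, W[7^∞])` finite — the shape `ord₇ f(0) = n₀` makes `Sel^γ` finite
  (`eulerIdentity_of_hasCharValuationAt`, Greenberg's Lemma 4.2 on the dual pair) and exact control for
  𝒞₇ (`strictControl_frame_finite_iff_of_classCSeven`, both local no-`7`-torsion inputs discharged)
  moves finiteness to the bottom layer.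
* §2 `finite_strictSelmerPInfty_of_strictTorsionSeven`: hence the fact-free item implies
  `Sel_str(W/ℚ)[7^∞]` finite for EVERY globally minimal `W ∈ 𝒞₇` (the frame `(ℚ(√−7), 𝔭, C • W^{(−7)}, C)`
  and an anticyclotomic `ℤ_7`-extension with a topological generator exist unconditionally, as in
  ram's `frameDataSeven_of_GZK`; then §1 and (D♮)).
* §3 `strictTorsionSeven_iff_finite_strictSelmerPInfty`: conversely that finiteness suffices (the frame
  twin of a member is a member, `classCSeven_of_isFrame`, k7r-c2; then (D♮) and g0's reduction), so
  **crux #3 ⟺ `∀` globally minimal `W ∈ 𝒞₇`, `Sel_str(W/ℚ)[7^∞]` finite** — no named fact on either side.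
* §4 `finite_shaPrimary_of_strictTorsionSeven`: for members with a rational point of infinite order the
  item yields `Ш(W/ℚ)[7^∞]` finite (`#Ш[7^∞] ∣ #Sel_str`, the sibling cell's UNCONDITIONAL
  `StrictSha.strictSelmerDominatesShaAt_holds`) — the `7`-primary Kolyvagin finiteness on the
  INFINITE class 𝒞₇ (all admissible twists `49a1^{(D)}` of analytic rank one, `X12.ClassCSeven`), which
  the tree holds only as the named fact GZK. VERDICT for the planner: the item cannot close fact-free in
  the tree's current state; D75 twin `StrictTorsionSevenOfGZK := GZK → …` (closed verbatim by
  `strictTorsionSeven_of_GZK`) — the K7r precedent `FrameDataSevenOfGZK` (stmt-19122).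
* §5 `cmRamifiedSeven_of_ellipticUnitIndexSeven`: the rung leaf `X12.CMRamifiedSeven` from crux #2
  `EllipticUnitIndexSeven` and `PublishedFactsSeven` ALONE (cruxes #3, #4 and the frame data discharged:
  `strictTorsionSeven_of_publishedFactsSeven`, `StrictControlSeven_proof`, `frameDataSevenOfGZK_proof`)
  — the live K7r cone is crux #2 (FRONTIER of record) + the facts.

References: [GreenbergLNM1716] §1 p. 61, §2 pp. 62–63, §3 Lemmas 3.1–3.3, §4 Lemma 4.2 (p. 102);
[Skinner2020] §2.2 (strict Selmer groups); [DokchitserDokchitserAnnals2010] Lemma 4.14;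
[Castella2018] Def. 2.2; [GrossZagier1986] Thm. I.(7.3) and [Kolyvagin1990] Thm. A (the named fact
GZK this shadows); [Washington1997] Thm. 13.4 (the anticyclotomic `ℤ_p`-extension);
[BurungaleKobayashiNakamuraOta2026] Prop. 3.7 (2) (arXiv:2608.06879; context only, nothing used).
-/

noncomputable section

open scoped Classical

open WeierstrassCurve NumberField IsDedekindDomain Field
  Literature.NumberTheory.EllipticCurves
  Literature.NumberTheory.EllipticCurves.Rank1Residual
  Literature.NumberTheory.GaloisRepresentations
  Summit.BirchSwinnertonDyer.Rank1Residual
  Summit.BirchSwinnertonDyer.Rank1Residual.Additive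
  Summit.BirchSwinnertonDyer.Rank1Residual.X11b
  Summit.BirchSwinnertonDyer.Rank1Residual.X11b.AcSelmer

namespace Summit.BirchSwinnertonDyer.BirchSwinnertonDyer.Theorems.RamifiedSevenEllipticUnits

/-! ## §1 (R-tors) at a framed member forces the bottom-layer strict Selmer group finite -/

section Frame

/-- **(R-tors) at a framed `W ∈ 𝒞₇` forces `Sel_𝔭(K, W[7^∞])` finite.** Given an anticyclotomic
`ℤ_7`-extension `κ` of the frame field with topological generator `γ`: (R-tors) supplies the shape
`ord₇ f(0) = n₀` of the strict anticyclotomic Selmer dual, whence the `γ`-invariants `Sel^γ` are finite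
(`eulerIdentity_of_hasCharValuationAt`: Greenberg's Lemma 4.2 on the dual pair), and exact control for
𝒞₇ (`strictControl_frame_finite_iff_of_classCSeven`: `Sel^γ` finite ⟺ `Sel_𝔭(K, W[7^∞])` finite, both
local no-`7`-torsion inputs discharged by k7r-c4) transfers finiteness to the bottom layer.
[cite: GreenbergLNM1716, §4 Lemma 4.2 (p. 102) and §3 Lemmas 3.1–3.3] -/
theorem finite_selmerAcBase_of_ramifiedCMStrictTorsionAt
    (W : WeierstrassCurve ℚ) [W.IsElliptic] [W.IsGloballyMinimal] [Fact (Nat.Prime 7)]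
    (hC : X12.ClassCSeven W) (htors : X12.O11.RamifiedCMStrictTorsionAt W 7)
    {K : Type} [Field K] [NumberField K] {𝔭 : HeightOneSpectrum (𝓞 K)}
    {W' : WeierstrassCurve ℚ} [W'.IsElliptic] [W'.IsGloballyMinimal] {C : VariableChange ℚ}
    (hF : X12.O11.IsFrame W 7 K 𝔭 W' C) (κ : ZpExtension K 7) (hκ : κ.IsAnticyclotomic)
    (γ : absoluteGaloisGroup K) [Fact (κ.IsTopGenerator γ)] :
    Finite (selmerAcBase (W.baseChange K) 7 𝔭 ∅) := by
  haveI : (W.baseChange K).IsElliptic := by rw [baseChange]; infer_instance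
  obtain ⟨⟨n₀, hn₀⟩, -⟩ := htors K 𝔭 W' C hF hC.2.2.1 κ hκ γ
  have hinv := (eulerIdentity_of_hasCharValuationAt (W.baseChange K) 7 κ 𝔭 γ hn₀).1
  exact (strictControl_frame_finite_iff_of_classCSeven hC hF κ γ).mp hinv

/-- **… hence both `ℚ`-side strict `7^∞`-Selmer groups of the frame are finite** ((D♮),
`finite_selmerAcBase_frame_iff`). [cite: GreenbergLNM1716, §4 Lemma 4.2 (p. 102)]
[cite: DokchitserDokchitserAnnals2010, Lemma 4.14 (proof)] -/
theorem finite_strictSelmerPInfty_frame_of_ramifiedCMStrictTorsionAt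
    (W : WeierstrassCurve ℚ) [W.IsElliptic] [W.IsGloballyMinimal] [Fact (Nat.Prime 7)]
    (hC : X12.ClassCSeven W) (htors : X12.O11.RamifiedCMStrictTorsionAt W 7)
    {K : Type} [Field K] [NumberField K] {𝔭 : HeightOneSpectrum (𝓞 K)}
    {W' : WeierstrassCurve ℚ} [W'.IsElliptic] [W'.IsGloballyMinimal] {C : VariableChange ℚ}
    (hF : X12.O11.IsFrame W 7 K 𝔭 W' C) (κ : ZpExtension K 7) (hκ : κ.IsAnticyclotomic)
    (γ : absoluteGaloisGroup K) [Fact (κ.IsTopGenerator γ)] :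
    Finite ↥(strictSelmerPInfty W 7) ∧ Finite ↥(strictSelmerPInfty W' 7) :=
  (finite_selmerAcBase_frame_iff W K 𝔭 W' C hF).mp
    (finite_selmerAcBase_of_ramifiedCMStrictTorsionAt W hC htors hF κ hκ γ)

end Frame

/-! ## §2 The fact-free item implies `Sel_str(W/ℚ)[7^∞]` finite on all of 𝒞₇ -/

section Converse

/-- **A frame and an anticyclotomic tower exist for every `W ∈ 𝒞₇`, unconditionally** (the
construction of ram's `frameDataSeven_of_GZK` without its Mordell–Weil part): the CM field
`K = ℚ(√−7)` (`Quadratic.exists_numberField_discr_eq` at the fundamental discriminant `−7`), a prime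
`𝔭 ∋ 7`, the globally minimal frame twin `W' = C • W^{(−7)}` (`hasGlobalMinimalModel_rat_holds`), an
anticyclotomic `ℤ_7`-extension of `K` (`ZpExtension.exists_isAnticyclotomic_holds`) and a topological
generator (`exists_isTopGenerator`). [cite: Washington1997, Thm. 13.4]
[cite: SilvermanAEC2009, Cor. VIII.8.3 (global minimal models over ℚ)] -/
theorem exists_isFrame_and_anticyclotomic (W : WeierstrassCurve ℚ) [W.IsElliptic]
    (hCM : W.HasCM) (hj : cmFieldDiscrOfJ W.j = -7) :
    ∃ (K : Type) (_ : Field K) (_ : NumberField K) (𝔭 : HeightOneSpectrum (𝓞 K))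
      (W' : WeierstrassCurve ℚ) (_ : W'.IsElliptic) (_ : W'.IsGloballyMinimal) (C : VariableChange ℚ)
      (κ : ZpExtension K 7) (γ : absoluteGaloisGroup K),
      X12.O11.IsFrame W 7 K 𝔭 W' C ∧ κ.IsAnticyclotomic ∧ κ.IsTopGenerator γ := by
  -- the CM field `K = ℚ(√−7)` and a prime above `7`
  obtain ⟨K, _, _, h2, hdK⟩ :=
    Literature.NumberTheory.QuadraticFields.Quadratic.exists_numberField_discr_eq (D := -7)
      (Or.inl ⟨by norm_num, by
        rw [← Int.squarefree_natAbs]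
        exact (Nat.prime_iff.mp (by norm_num : Nat.Prime 7)).squarefree, by norm_num⟩)
  have hK : IsImaginaryQuadratic K :=
    isImaginaryQuadratic_iff_discr_neg.mpr ⟨h2, by rw [hdK]; norm_num⟩
  obtain ⟨𝔭, h𝔭⟩ :=
    Literature.NumberTheory.Automorphic.PatchingFamily.exists_heightOneSpectrum_natCast_mem K
      (p := 7) (by norm_num)
  -- the frame twin
  have hd0 : ((cmFieldDiscrOfJ W.j : ℤ) : ℚ) ≠ 0 := by rw [hj]; norm_num
  haveI := W.isElliptic_quadraticTwist hd0
  obtain ⟨C, hCmin⟩ :=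
    hasGlobalMinimalModel_rat_holds (W.quadraticTwist ((cmFieldDiscrOfJ W.j : ℤ) : ℚ))
  have hF : X12.O11.IsFrame W 7 K 𝔭 (C • W.quadraticTwist ((cmFieldDiscrOfJ W.j : ℤ) : ℚ)) C := by
    refine ⟨hCM, ?_, by norm_num, hK, by rw [hdK, hj], h𝔭, rfl⟩
    change ((7 : ℕ) : ℤ) ∣ cmFieldDiscrOfJ W.j
    rw [hj]; norm_num
  -- the anticyclotomic `ℤ_7`-extension and a topological generator
  obtain ⟨κ, hκ⟩ := ZpExtension.exists_isAnticyclotomic_holds (K := K) (p := 7) h2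
    (fun w => hK.2.isComplex w)
  obtain ⟨γ, hγ⟩ := κ.exists_isTopGenerator
  exact ⟨K, inferInstance, inferInstance, 𝔭, _, inferInstance, hCmin, C, κ, γ, hF, hκ, hγ⟩

/-- **What the fact-free crux contains: `Sel_str(W/ℚ)[7^∞]` finite for EVERY globally minimal
`W ∈ 𝒞₇`.** Instantiate (R-tors) at the unconditional frame and tower of
`exists_isFrame_and_anticyclotomic` and apply §1. Since 𝒞₇ is an infinite class, this bounds the
`ℤ₇`-corank of `Sel_{7^∞}(W/ℚ)` by `1` on the whole class — a Kolyvagin-strength statement the tree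
holds only as the named fact GZK. [cite: GreenbergLNM1716, §4 Lemma 4.2 (p. 102)] [cite: Skinner2020, §2.2] -/
theorem finite_strictSelmerPInfty_of_strictTorsionSeven
    (h : Summit.BirchSwinnertonDyer.BirchSwinnertonDyer.Theses.RamifiedSevenEllipticUnits.StrictTorsionSeven)
    (W : WeierstrassCurve ℚ) [W.IsElliptic] [W.IsGloballyMinimal] [Fact (Nat.Prime 7)]
    (hC : X12.ClassCSeven W) : Finite ↥(strictSelmerPInfty W 7) := by
  obtain ⟨K, _, _, 𝔭, W', _, _, C, κ, γ, hF, hκ, hγ⟩ :=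
    exists_isFrame_and_anticyclotomic W hC.1 hC.2.1
  haveI : Fact (κ.IsTopGenerator γ) := ⟨hγ⟩
  exact (finite_strictSelmerPInfty_frame_of_ramifiedCMStrictTorsionAt W hC (h W hC) hF κ hκ γ).1

end Converse

/-! ## §3 The exact content of crux #3 -/

section Iff

/-- **Crux #3 IS the finiteness of the strict `7^∞`-Selmer group over `ℚ` on 𝒞₇**:
`StrictTorsionSeven ↔ ∀` globally minimal `W ∈ 𝒞₇`, `Sel_str(W/ℚ)[7^∞]` finite. (→) is §2. (←): at a
frame `(K, 𝔭, W', C)` of a member `W` the twin `W'` is again a globally minimal member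
(`classCSeven_of_isFrame`, k7r-c2), so both `ℚ`-side strict groups are finite, hence `Sel_𝔭(K, W[7^∞])`
is finite ((D♮), `finite_selmerAcBase_frame_iff`) and g0's reduction `strictTorsionSeven_of_finite_base`
concludes. No named fact enters either direction; under GZK the right-hand side holds
(`finite_strictSelmerPInfty_of_GZK`, g0) — which is `strictTorsionSeven_of_GZK` again.
[cite: GreenbergLNM1716, §1 p. 61 and §4 Lemma 4.2 (p. 102)] [cite: Skinner2020, §2.2]
[cite: DokchitserDokchitserAnnals2010, Lemma 4.14 (proof)] -/
theorem strictTorsionSeven_iff_finite_strictSelmerPInfty :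
    Summit.BirchSwinnertonDyer.BirchSwinnertonDyer.Theses.RamifiedSevenEllipticUnits.StrictTorsionSeven ↔
      ∀ (W : WeierstrassCurve ℚ) [W.IsElliptic] [W.IsGloballyMinimal] [Fact (Nat.Prime 7)],
        X12.ClassCSeven W → Finite ↥(strictSelmerPInfty W 7) := by
  refine ⟨fun h W _ _ _ hC ↦ finite_strictSelmerPInfty_of_strictTorsionSeven h W hC, fun h ↦ ?_⟩
  exact strictTorsionSeven_of_finite_base fun W _ _ _ hC K _ _ 𝔭 W' _ _ C hF _ ↦
    (finite_selmerAcBase_frame_iff W K 𝔭 W' C hF).mpr ⟨h W hC, h W' (classCSeven_of_isFrame hF hC)⟩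

/-- **Equivalently, crux #3 ⟺ (F) on 𝒞₇**: `Sel_𝔭(K, W[7^∞])` finite at every O11 frame at `7` of
every globally minimal member (the input of g0's `strictTorsionSeven_of_finite_base`, now shown to be
not only sufficient but necessary). The analytic-rank clause of the frame binders is automatic on 𝒞₇.
[cite: GreenbergLNM1716, §3 Lemmas 3.1–3.3 and §4 Lemma 4.2 (p. 102)] -/
theorem strictTorsionSeven_iff_finite_selmerAcBase :
    Summit.BirchSwinnertonDyer.BirchSwinnertonDyer.Theses.RamifiedSevenEllipticUnits.StrictTorsionSeven ↔
      ∀ (W : WeierstrassCurve ℚ) [W.IsElliptic] [W.IsGloballyMinimal] [Fact (Nat.Prime 7)],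
        X12.ClassCSeven W →
        ∀ (K : Type) [Field K] [NumberField K] (𝔭 : HeightOneSpectrum (𝓞 K))
          (W' : WeierstrassCurve ℚ) [W'.IsElliptic] [W'.IsGloballyMinimal] (C : VariableChange ℚ),
          X12.O11.IsFrame W 7 K 𝔭 W' C → Finite (selmerAcBase (W.baseChange K) 7 𝔭 ∅) := by
  refine ⟨fun h W _ _ _ hC K _ _ 𝔭 W' _ _ C hF ↦ ?_,
    fun h ↦ strictTorsionSeven_of_finite_base fun W _ _ _ hC K _ _ 𝔭 W' _ _ C hF _ ↦
      h W hC K 𝔭 W' C hF⟩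
  have hfin := strictTorsionSeven_iff_finite_strictSelmerPInfty.mp h
  exact (finite_selmerAcBase_frame_iff W K 𝔭 W' C hF).mpr
    ⟨hfin W hC, hfin W' (classCSeven_of_isFrame hF hC)⟩

end Iff

/-! ## §4 The shadow on `Ш` -/

section Sha

/-- **(R-tors)@7 on 𝒞₇ ⟹ `Ш(W/ℚ)[7^∞]` finite for every globally minimal member with a rational
point of infinite order.** By §2 the strict `7^∞`-Selmer group of `W` is finite, and in rank `≥ 1`
every class of `Ш[7^∞]` has a strict representative, `#Ш(W)[7^∞] ∣ #Sel_str(W/ℚ)[7^∞]` (the sibling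
cell's UNCONDITIONAL `StrictSha.strictSelmerDominatesShaAt_holds`). This is the `7`-primary Kolyvagin
finiteness on the infinite class 𝒞₇ — the recognisable reason the fact-free item is GZK-hard.
[cite: GreenbergLNM1716, §2 (pp. 62–63)] [cite: Kolyvagin1990, Thm. A (the statement this shadows)] -/
theorem finite_shaPrimary_of_strictTorsionSeven
    (h : Summit.BirchSwinnertonDyer.BirchSwinnertonDyer.Theses.RamifiedSevenEllipticUnits.StrictTorsionSeven)
    (W : WeierstrassCurve ℚ) [W.IsElliptic] [W.IsGloballyMinimal] [Fact (Nat.Prime 7)]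
    (hC : X12.ClassCSeven W) (hrk : 1 ≤ W.mordellWeilRank) :
    Finite (AddCommGroup.primaryComponent W.sha 7) := by
  haveI := finite_strictSelmerPInfty_of_strictTorsionSeven h W hC
  refine Nat.finite_of_card_ne_zero fun h0 ↦ ?_
  have hdvd := StrictSha.strictSelmerDominatesShaAt_holds W 7 hrk
  rw [h0, zero_dvd_iff] at hdvd
  exact Nat.card_pos.ne' hdvd

end Sha

/-! ## §5 The rung leaf from crux #2 and the published facts alone -/

section Leaf

/-- **The rung leaf K7r from crux #2 and the published facts alone.** With crux #4
(`StrictControlSeven_proof`, k7r-c4), the GZK-conditional frame data (`frameDataSevenOfGZK_proof`, ram)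
and crux #3 (`strictTorsionSeven_of_publishedFactsSeven`, k7r-c4 g2) all discharged, the leaf
`X12.CMRamifiedSeven` follows from `EllipticUnitIndexSeven` and `PublishedFactsSeven` by the
Theorems-side bridge `CMRungInputs.cmRamifiedSeven_of_inputs` — the composition a re-glued `closes`
would be (it cannot literally be the route's `closes`: this module imports the route file). CONDITIONAL
on crux #2 (OPEN, FRONTIER of record) and on the named facts of item 19147.
[cite: Miller2011LMS, Def. 1.1] [cite: Kolyvagin1990, Thm. A] -/
theorem cmRamifiedSeven_of_ellipticUnitIndexSeven
    (h₁ : Summit.BirchSwinnertonDyer.BirchSwinnertonDyer.Theses.RamifiedSevenEllipticUnits.EllipticUnitIndexSeven)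
    (h₅ : Summit.BirchSwinnertonDyer.BirchSwinnertonDyer.Theses.RamifiedSevenEllipticUnits.PublishedFactsSeven) :
    Summit.BirchSwinnertonDyer.Rank1Residual.X12.CMRamifiedSeven :=
  Summit.BirchSwinnertonDyer.BirchSwinnertonDyer.Rank1Residual.CMRungInputs.cmRamifiedSeven_of_inputs
    h₁ (strictTorsionSeven_of_publishedFactsSeven h₅) StrictControlSeven_proof
    (frameDataSevenOfGZK_proof h₅.2.2.2.2.2.2.1) h₅

end Leaf

end Summit.BirchSwinnertonDyer.BirchSwinnertonDyer.Theorems.RamifiedSevenEllipticUnits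

end
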